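import Literature.MathematicalPhysics.QuantumLattice.YangMillsClassical
import Mathlib.Analysis.Calculus.FDeriv.Symmetric
import HarnessLib

/-!
# Pure-gauge connections are flat: discharge of `Literature.MathematicalPhysics.QuantumLattice.isFlat_pureGauge`

Trunk T-QLATTICE / T-AQFT (item G13). Sibling proof file of
`Literature/MathematicalPhysics/QuantumLattice/YangMillsClassical.lean` (kept separate from
`YangMillsClassicalProofs.lean`, which holds the `ymDensity_eq_of_orthonormalBasis` discharge, so
that whole-file proposals to either do not overwrite the other): it discharges the named
fact `Literature.MathematicalPhysics.QuantumLattice.isFlat_pureGauge` (D-0014) as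
`theorem Literature.AQFT.isFlat_pureGauge_holds : isFlat_pureGauge`, i.e. for a `C²` gauge
transformation `g : E → 𝔸ˣ` on flat space `E` the pure-gauge connection
`pureGauge g = g • 0 = −(dg) g⁻¹` has vanishing curvature, and its pointwise form
`Literature.MathematicalPhysics.QuantumLattice.curvature_pureGauge` as `Literature.MathematicalPhysics.QuantumLattice.curvature_pureGauge_holds`. No statement is introduced
or changed here; the two auxiliary lemmas are proof infrastructure (derivative formulas, proved).

## Sources

S. K. Donaldson, P. B. Kronheimer, *The Geometry of Four-Manifolds* (OUP 1990), §2.1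
(transformation law of the curvature under gauge transformations, (2.1.7)–(2.1.8):
`F_{g•A} = g F_A g⁻¹`) and §2.2.1 (flat connections: vanishing curvature is the integrability
condition for being locally gauge equivalent to the product connection, whose connection
matrices are exactly the pure gauges `−(dg) g⁻¹`); A. Jaffe, E. Witten, *Quantum Yang–Mills
theory* (2000), §1. The statement is folklore; the book is not held in the literature store
(acquisition request filed), so no page numbers are quoted. The proof below is the standard
direct flat-space computation rather than the route through the (here still named) fact
`Literature.MathematicalPhysics.QuantumLattice.curvature_gaugeAct`.

## Proof architecture

Write `θ(y)(w) = (∂_w g)(y) g(y)⁻¹`, so `pureGauge g y w = −θ(y)(w)` (`pureGauge_apply`).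
* `hasFDerivAt_val_inv_units`: `d(g⁻¹) = −g⁻¹ (dg) g⁻¹`, the chain rule with Mathlib's
  `hasFDerivAt_ringInverse` (this is where the fact's ambient hypothesis
  `[HasSummableGeomSeries 𝔸]` is used).
* `hasFDerivAt_pureGauge_apply`: by the Leibniz rule (`HasFDerivAt.mul'`),
  `∂ᵤ θ(v) = D²g(u, v) g⁻¹ − θ(v) θ(u)`, where `D²g = fderiv (fderiv g)` exists because `g` is
  `C²` (`ContDiff.fderiv_right`).
* `isFlat_pureGauge_holds`: `F_{−θ}(u, v) = −∂ᵤ θ(v) + ∂ᵥ θ(u) + [θ(u), θ(v)]`; the second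
  derivative of a `C²` map between real normed spaces is symmetric
  (`second_derivative_symmetric`), so the `D²g` terms cancel and the remaining four products
  cancel in the (noncommutative) ring `𝔸` (`noncomm_ring`).
-/

noncomputable section

open scoped RightActions

namespace Literature.MathematicalPhysics.QuantumLattice

variable {E : Type*} [NormedAddCommGroup E] [InnerProductSpace ℝ E]
variable {𝔸 : Type*} [NormedRing 𝔸] [NormedAlgebra ℝ 𝔸]

/-- Derivative of the pointwise inverse of a units-valued map: if `y ↦ g(y)` has derivative `G'`
at `x`, then `y ↦ g(y)⁻¹` has derivative `w ↦ −g(x)⁻¹ (G' w) g(x)⁻¹` (chain rule with Mathlib's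
`hasFDerivAt_ringInverse`; standard calculus in a Banach algebra). [folklore] -/
theorem hasFDerivAt_val_inv_units [HasSummableGeomSeries 𝔸] (g : E → 𝔸ˣ) {G' : E →L[ℝ] 𝔸}
    {x : E} (hg : HasFDerivAt (fun y => (g y : 𝔸)) G' x) :
    HasFDerivAt (fun y => (((g y)⁻¹ : 𝔸ˣ) : 𝔸))
      ((-ContinuousLinearMap.mulLeftRight ℝ 𝔸 ((g x)⁻¹ : 𝔸ˣ) ((g x)⁻¹ : 𝔸ˣ)).comp G') x := by
  have hfun : (fun y => (((g y)⁻¹ : 𝔸ˣ) : 𝔸)) = Ring.inverse ∘ fun y => (g y : 𝔸) := by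
    funext y
    simp
  rw [hfun]
  exact (hasFDerivAt_ringInverse (g x)).comp x hg

/-- The components `y ↦ (g • 0)(y)(w) = −(∂_w g)(y) g(y)⁻¹` of a pure-gauge connection built from
a `C²` gauge transformation are differentiable, with derivative
`u ↦ −(D²g(x)(u, w) g⁻¹ − (∂_w g) g⁻¹ (∂ᵤ g) g⁻¹)` (Leibniz rule; the calculus step of the
flatness computation for `isFlat_pureGauge_holds`). [folklore] -/
theorem hasFDerivAt_pureGauge_apply [HasSummableGeomSeries 𝔸] (g : E → 𝔸ˣ)
    (hg : ContDiff ℝ 2 fun y => (g y : 𝔸)) (x w : E) :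
    HasFDerivAt (fun y => pureGauge g y w)
      (-((fderiv ℝ (fun y => (g y : 𝔸)) x w) •
          ((-ContinuousLinearMap.mulLeftRight ℝ 𝔸 ((g x)⁻¹ : 𝔸ˣ) ((g x)⁻¹ : 𝔸ˣ)).comp
            (fderiv ℝ (fun y => (g y : 𝔸)) x)) +
        ((ContinuousLinearMap.apply ℝ 𝔸 w).comp
            (fderiv ℝ (fderiv ℝ (fun y => (g y : 𝔸))) x)) <• (((g x)⁻¹ : 𝔸ˣ) : 𝔸))) x := by
  have h1 : Differentiable ℝ fun y => (g y : 𝔸) := hg.differentiable (by norm_num)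
  have h2 : Differentiable ℝ (fderiv ℝ fun y => (g y : 𝔸)) :=
    (hg.fderiv_right (m := 1) (by norm_num)).differentiable (by norm_num)
  have hfun : (fun y => pureGauge g y w) =
      fun y => -(fderiv ℝ (fun y => (g y : 𝔸)) y w * (((g y)⁻¹ : 𝔸ˣ) : 𝔸)) := by
    funext y
    exact pureGauge_apply g y w
  rw [hfun]
  exact (((ContinuousLinearMap.apply ℝ 𝔸 w).hasFDerivAt.comp x (h2 x).hasFDerivAt).mul'
    (hasFDerivAt_val_inv_units g (h1 x).hasFDerivAt)).neg

/-- Discharge of the named fact `isFlat_pureGauge`: for a `C²` gauge transformation `g`, the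
pure-gauge connection `g • 0 = −(dg) g⁻¹` is flat, `F_{g•0} = 0`. Direct computation from
`d(g⁻¹) = −g⁻¹ (dg) g⁻¹` and the symmetry of `D²g`. Donaldson–Kronheimer, *The Geometry of
Four-Manifolds* (1990), §2.2.1 with (2.1.8). [folklore] -/
theorem isFlat_pureGauge_holds [HasSummableGeomSeries 𝔸] :
    isFlat_pureGauge (E := E) (𝔸 := 𝔸) := by
  intro g hg x u v
  have h1 : Differentiable ℝ fun y => (g y : 𝔸) := hg.differentiable (by norm_num)
  have h2 : Differentiable ℝ (fderiv ℝ fun y => (g y : 𝔸)) :=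
    (hg.fderiv_right (m := 1) (by norm_num)).differentiable (by norm_num)
  have hsymm : fderiv ℝ (fderiv ℝ fun y => (g y : 𝔸)) x u v =
      fderiv ℝ (fderiv ℝ fun y => (g y : 𝔸)) x v u :=
    second_derivative_symmetric (fun y => (h1 y).hasFDerivAt) (h2 x).hasFDerivAt u v
  rw [curvature, (hasFDerivAt_pureGauge_apply g hg x v).fderiv,
    (hasFDerivAt_pureGauge_apply g hg x u).fderiv]
  simp only [pureGauge_apply, neg_apply, add_apply, smul_apply, ContinuousLinearMap.comp_apply,
    ContinuousLinearMap.mulLeftRight_apply, ContinuousLinearMap.apply_apply, smul_eq_mul,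
    MulOpposite.smul_eq_mul_unop, MulOpposite.unop_op, Ring.lie_def, hsymm]
  noncomm_ring

/-- Discharge of the named fact `curvature_pureGauge` (pointwise form of `isFlat_pureGauge`):
`F_{−(dg)g⁻¹}(x)(u,v) = 0` for `C²` gauge transformations. Donaldson–Kronheimer §2.2.1. [folklore] -/
theorem curvature_pureGauge_holds [HasSummableGeomSeries 𝔸] :
    curvature_pureGauge (E := E) (𝔸 := 𝔸) :=
  fun g hg x u v => isFlat_pureGauge_holds g hg x u v

end Literature.MathematicalPhysics.QuantumLattice
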